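import Summits.Ventures.QEC.CircuitDistance.ETowerOrbit
import Summits.Ventures.QEC.CircuitDistance.PortLeafWFFast
import HarnessLib

/-!
# P3-PORT STEP 2 (E-fold tower): the BASE CERTIFICATE format — per-slice representative checks and per-weight orbit-size sums
# (CARD-7 §4/§5 S6 (c), PORT-SPEC S6 (c); cell `qec`, experiment CDX, seat qec-cdx-type-1)

The base list `T₃` (≈ 62 500 orbit representatives per sector) is emitted as slices `T₃ = S₀ ++ S₁ ++ …`; per slice ONE
`decide +kernel` fact `sliceCheck col ls ms nb W Sᵢ = true` (each entry: below `2^n`, kernel word, weight in `[1, W]`,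
orbit-minimal) and ONE fact `osums ls ms nb W Sᵢ = [σ₁, …, σ_W]` (orbit-size sums per weight); globally ONE sortedness fact
(`Fibre.incr T₃` of `PortLeafWFFast`, hence `Nodup`).  `base_of_slices` turns these, plus the counts `#X_w` (weight-enumerator DP, S6b), into the `hbase`
hypothesis of `ETowerSound.kc_of_tower`.  The checker is written over the generic `transWK / lin / popc` (≈ 10⁴ kernel steps per
45-slot representative); a table-driven fast checker can be bolted on by proving it implies `sliceCheck`.  Generic; no data.
-/

namespace Summit.Ventures.QEC.CircuitDistance.ETower

open Summit.Ventures.QEC.Census Summit.Ventures.QEC.Census.Fold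

/-! ## The per-slice checks -/

/-- One representative: in the window, kernel word, weight in `[1, W]`, orbit-minimal. -/
def repCheck (col : ℕ → ℕ) (ls ms nb W : ℕ) (r : ℕ) : Bool :=
  decide (r < 2 ^ (nb * (ls * ms))) && (lin col (nb * (ls * ms)) 0 r == 0) &&
    decide (1 ≤ popc (nb * (ls * ms)) r) && decide (popc (nb * (ls * ms)) r ≤ W) && canonical ls ms nb r

/-- A slice passes if every entry does. -/
def sliceCheck (col : ℕ → ℕ) (ls ms nb W : ℕ) (L : List ℕ) : Bool := L.all (repCheck col ls ms nb W)

/-- Orbit-size sum of the entries of weight `w`. -/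
def osum (ls ms nb w : ℕ) (L : List ℕ) : ℕ :=
  ((L.filter fun r => popc (nb * (ls * ms)) r == w).map (orbitSize ls ms nb)).sum

/-- The vector of orbit-size sums for weights `1 … W`. -/
def osums (ls ms nb W : ℕ) (L : List ℕ) : List ℕ := (List.range W).map fun i => osum ls ms nb (i + 1) L

/-! ## Additivity over slices -/

/-- `osum` is additive over concatenation. -/
theorem osum_append (ls ms nb w : ℕ) (L₁ L₂ : List ℕ) :
    osum ls ms nb w (L₁ ++ L₂) = osum ls ms nb w L₁ + osum ls ms nb w L₂ := by
  unfold osum; rw [List.filter_append, List.map_append, List.sum_append]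

/-- `osums` is additive over concatenation (componentwise). -/
theorem osums_append (ls ms nb W : ℕ) (L₁ L₂ : List ℕ) :
    osums ls ms nb W (L₁ ++ L₂) = List.zipWith (· + ·) (osums ls ms nb W L₁) (osums ls ms nb W L₂) := by
  unfold osums
  rw [List.zipWith_map_left, List.zipWith_map_right, List.zipWith_self]
  exact List.map_congr_left fun i _ => osum_append ls ms nb (i + 1) L₁ L₂

/-- Reading entry `w − 1` of `osums`. -/
theorem osums_getD {ls ms nb W w : ℕ} (h1 : 1 ≤ w) (hw : w ≤ W) (L : List ℕ) :
    (osums ls ms nb W L).getD (w - 1) 0 = osum ls ms nb w L := by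
  unfold osums
  rw [List.getD_eq_getElem _ _ (by rw [List.length_map, List.length_range]; omega), List.getElem_map, List.getElem_range,
    Nat.sub_add_cancel h1]

/-- `sliceCheck` is multiplicative over concatenation. -/
theorem sliceCheck_append {col : ℕ → ℕ} {ls ms nb W : ℕ} {L₁ L₂ : List ℕ} (h₁ : sliceCheck col ls ms nb W L₁ = true)
    (h₂ : sliceCheck col ls ms nb W L₂ = true) : sliceCheck col ls ms nb W (L₁ ++ L₂) = true := by
  unfold sliceCheck at *; rw [List.all_append, h₁, h₂]; rfl

/-! ## From slices to the base hypothesis -/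

/-- What a passing slice says about its entries. -/
theorem of_sliceCheck {col : ℕ → ℕ} {ls ms nb W : ℕ} {L : List ℕ} (h : sliceCheck col ls ms nb W L = true) :
    ∀ r ∈ L, r < 2 ^ (nb * (ls * ms)) ∧ kerK col (nb * (ls * ms)) r ∧ 1 ≤ popc (nb * (ls * ms)) r ∧
      popc (nb * (ls * ms)) r ≤ W ∧ canonical ls ms nb r = true := by
  intro r hr
  unfold sliceCheck at h
  rw [List.all_eq_true] at h
  have := h r hr
  unfold repCheck at this
  simp only [Bool.and_eq_true, decide_eq_true_eq, beq_iff_eq] at this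
  obtain ⟨⟨⟨⟨h1, h2⟩, h3⟩, h4⟩, h5⟩ := this
  exact ⟨h1, h2, h3, h4, h5⟩

/-- **BASE HYPOTHESIS FROM THE CERTIFICATE.**  A strictly increasing list `T` passing `sliceCheck` (e.g. assembled from slices
by `sliceCheck_append`) whose orbit-size sums per weight `1 … W` equal the kernel-word counts `#X_w`: every kernel word of
weight `≤ W` on the window is `0` or a translate of an entry of `T` — the `hbase` hypothesis of `kc_of_tower`. -/
theorem base_of_slices {ls ms : ℕ} (hl : 0 < ls) (hm : 0 < ms) {col : ℕ → ℕ} {nb W : ℕ}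
    (hK : ∀ da db s, s < 2 ^ (nb * (ls * ms)) → (kerK col (nb * (ls * ms)) s ↔ kerK col (nb * (ls * ms)) (transWK ls ms nb da db s)))
    (T : List ℕ) (hcheck : sliceCheck col ls ms nb W T = true) (hincr : Fibre.incr T = true)
    (hcount : ∀ w, 1 ≤ w → w ≤ W → osum ls ms nb w T = (Xw col ls ms nb w).card) :
    ∀ s, s < 2 ^ (nb * (ls * ms)) → kerK col (nb * (ls * ms)) s → popc (nb * (ls * ms)) s ≤ W →
      s = 0 ∨ MatchedK ls ms nb T s := by
  have hT := of_sliceCheck hcheck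
  exact base_of_orbit_count hl hm hK T (fun r hr => (hT r hr).1) (fun r hr => (hT r hr).2.1)
    (fun r hr => (hT r hr).2.2.2.2) (Fibre.nodup_of_incr hincr) (fun w h1 hw => hcount w h1 hw)

end Summit.Ventures.QEC.CircuitDistance.ETower
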